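import Summits.BirchSwinnertonDyer.BirchSwinnertonDyer.Theorems.ByReductionTypeAtTwoSupersingularFlatBlindHondaRung
import HarnessLib

/-!
# Route `ByReductionTypeAtTwo` (rung K4), crux `SupersingularRankZeroAtTwo` (item stmt-BirchSwinnertonDyer-19097), line `odd_blind_package`
# (registered v2.6.1, tree v2.8) slot 5: **THE SHARP HONDA RUNG — EXACT TRANSVERSALITY `e(c) = 0`.**  For the `c`-part of a Honda system at
# two, every `ψ₂`-vector `y ∈ E(ℚ_{1,v})` outside `2^k E(ℚ_{1,v})` has a `z ∈ Ker Col♭_c` with `2^k ∤ z(y)` — exponent `k`, not `k + 1`: the ♭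
# functional restricted to the `ψ₂`-line is PRIMITIVE, `z(y₀)` is a `2`-ADIC UNIT, `#(L♭ ∩ K) = 2^{e(c)} = 1` (the input `t = 0` of the
# CDC count, -imc D-imc-67 (b3)/(b4), LEAD ss-1 GEN 20 `HOME/ss/gen20/HAND-TARGETS-CDC.md` §0/ADDENDUM 1).  Seat `bsd-2adic-ss-1` GEN 20.

HONEST FRAMING: THEOREMS ONLY (no definition, no named fact, no `sorry`, no instance); `--supports 19097`.  A STRENGTHENING of the landed
rung ★★★ p811371 `OddBlindLocal.flatBlindLocalTransversalityHondaOffZeroAtTwo` (whose conclusion `2^{k+1} ∤ z(y)` says `e ≤ 1`): same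
binders, conclusion `2^k ∤ z(y)` (`e = 0`).  It closes no registered stub; it is the Honda-side input for CDC_H's position term; BSD is
proved for no curve by any of this.

## The one change to GEN 19's chain
p811031 proved `4 ∤ W(−2)` for the Wronskian `W = a₀b₁ − a₁b₀` of two functionals with ODD slope (`not_four_dvd_evalAt_negTwo_of_not_two_dvd_coeff_one`)
and then WEAKENED it to `8 ∤` for the (K₈) interface.  Keeping `4 ∤`: the (K₄)-witness `z = b₁z₀ − b₀z₁ ∈ Ker Col♭` has
`z(g·c₁) − z(c₁) = W(−2) ≢ 0 (mod 4)`, and `z(g·c₁) − z(c₁) = −2·z(y₀)` (`(g−1)c₁ = −2y₀`) forces `z(y₀)` ODD; the rank-one identity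
`z(y₀)·u(y) = u(y₀)·z(y)` with a separating `u` (`2^k ∤ u(y)`) gives `2^k ∤ z(y)`.
* §1 `not_pow_dvd_mul_of_not_two_dvd`, ★ `not_pow_dvd_apply_of_not_four_dvd` ((Y″): mod-4 detection, exponent `k`),
  `exists_mem_colemanKer_flat_not_four_dvd_of_wronskian`, `exists_mem_colemanKer_flat_not_four_dvd_of_odd_slope` (generic base).
* §2 ★★ `flatBlindLocalTransversalityHondaOffZeroAtTwo_sharp` (over `ℚ`, `v ∋ 2`): the rung's binders verbatim, conclusion with `2^k`.

References: [Sprung2012] Thm. 2.2, Lemma 2.3 (p. 1487), Def. 5.9 (p. 1495), Def. 7.9 (p. 1503), Open Problem 7.22; [KuriharaPollack2007] Prop. 1.2 (shape);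
[SilvermanAEC2009] VII Prop. 6.3.
-/

set_option autoImplicit false
set_option linter.dupNamespace false

noncomputable section

open scoped Classical NumberField

universe u

namespace Summit.BirchSwinnertonDyer.BirchSwinnertonDyer.Theorems

namespace OddBlindLocal

open NumberField IsDedekindDomain Literature.NumberTheory.EllipticCurves Literature.NumberTheory.GaloisRepresentations
  ZpExtension Literature.NumberTheory.EllipticCurves.Kobayashi2003 Literature.NumberTheory.EllipticCurves.Sprung2017
  Literature.NumberTheory.EllipticCurves.Sprung2012 Literature.NumberTheory.EllipticCurves.Rank1Residual
  Summit.BirchSwinnertonDyer.Rank1Residual.F1Sign2 Summit.BirchSwinnertonDyer.Rank1Residual.Supersingular.BlindLever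

/-! ## §1 Generic base: mod-4 detection -/

section Generic

variable {K : Type u} [Field K] {κ : ZpExtension K 2}
variable {E : Type u} [Field E] [Algebra K E] {ι : AlgebraicClosure K →ₐ[K] AlgebraicClosure E}
variable {W : WeierstrassCurve K}

/-- In `ℤ₂`: if `2 ∤ a` and `2^k ∤ b` then `2^k ∤ a·b` (`a` is prime to `2`). [folklore] -/
theorem not_pow_dvd_mul_of_not_two_dvd {a b : ℤ_[2]} (ha : ¬ (2 : ℤ_[2]) ∣ a) {k : ℕ} (hb : ¬ (2 : ℤ_[2]) ^ k ∣ b) :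
    ¬ (2 : ℤ_[2]) ^ k ∣ a * b := by
  have h2 : Prime (2 : ℤ_[2]) := by exact_mod_cast (PadicInt.prime_p (p := 2))
  exact fun h ↦ hb (h2.pow_dvd_of_dvd_mul_left k ha h)

/-- ★ **(Y″) — MOD-4 FIRST-LAYER DETECTION, exponent `k`.**  (NT) no `2`-torsion in the tower; `(c₋, c)` a Honda system at two; `g` a local
lift of the topological generator; `z : E(K_∞·K_v) → ℤ₂` additive with `z(g·c₁) − z(c₁) ≢ 0 (mod 4)`.  Then `y ∈ E(K_1·K_v)`, `g·y = −y`,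
`y ∉ 2^k·E(K_1·K_v)` ⟹ `2^k ∤ z(y)`.  (`z(g·c₁) − z(c₁) = −2z(y₀)`, so `z(y₀)` is ODD; separation `u` with `2^k ∤ u(y)`; rank-one
identity `z(y₀)u(y) = u(y₀)z(y)`.)  The sharp twin of p810939's (Y′). [cite: Sprung2012, Thm. 2.2 (p. 1487) and Def. 7.9 (p. 1503)]
[cite: NeukirchSchmidtWingberg2008, I §1 (1.1.8)] -/
theorem not_pow_dvd_apply_of_not_four_dvd
    (hnt : ∀ P ∈ localTowerPointsOfEmb κ ι W, 2 • P = 0 → P = 0)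
    {a : ℤ} {g : Field.absoluteGaloisGroup E} (hg : κ.IsTopGenerator (resGalOfEmb ι g))
    {cneg : localPoints W E} {c : ℕ → localPoints W E} (hH : IsHondaSystemAtTwo κ ι W a g cneg c)
    (z : localTowerPointsOfEmb κ ι W →+ ℤ_[2])
    (hz : ¬ (4 : ℤ_[2]) ∣ z ⟨g • c 1, smul_mem_localTowerPointsOfEmb κ ι W g
        (localLayerPointsOfEmb_le_localTowerPointsOfEmb κ ι W 1 (hH.2.1 1))⟩ -
      z ⟨c 1, localLayerPointsOfEmb_le_localTowerPointsOfEmb κ ι W 1 (hH.2.1 1)⟩)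
    {y : localPoints W E} (hy : y ∈ localLayerPointsOfEmb κ ι W 1) (hgy : g • y = -y)
    {k : ℕ} (hndiv : ∀ w ∈ localLayerPointsOfEmb κ ι W 1, 2 ^ k • w ≠ y) :
    ¬ (2 : ℤ_[2]) ^ k ∣ z ⟨y, localLayerPointsOfEmb_le_localTowerPointsOfEmb κ ι W 1 hy⟩ := by
  have hle : localLayerPointsOfEmb κ ι W 1 ≤ localTowerPointsOfEmb κ ι W :=
    localLayerPointsOfEmb_le_localTowerPointsOfEmb κ ι W 1
  have hc1 : c 1 ∈ localLayerPointsOfEmb κ ι W 1 := hH.2.1 1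
  obtain ⟨s, hs, -, hgen⟩ := exists_twistGenerator_of_isHondaSystemAtTwo hg hH
  have hy₀ : c 1 - s ∈ localLayerPointsOfEmb κ ι W 1 :=
    sub_mem hc1 (localLayerPointsOfEmb_mono κ ι W (Nat.zero_le 1) hs)
  let ζ : localLayerPointsOfEmb κ ι W 1 →+ ℤ_[2] := z.comp (AddSubgroup.inclusion hle)
  have hζ : ∀ (x : localPoints W E) (hx : x ∈ localLayerPointsOfEmb κ ι W 1), ζ ⟨x, hx⟩ = z ⟨x, hle hx⟩ :=
    fun x hx ↦ rfl
  -- `z(g•c₁) − z(c₁) = −2·z(y₀)`, so `z(y₀)` is odd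
  have hval : z ⟨g • c 1, smul_mem_localTowerPointsOfEmb κ ι W g (hle hc1)⟩ - z ⟨c 1, hle hc1⟩ =
      -(2 * ζ ⟨c 1 - s, hy₀⟩) := by
    have e : (⟨g • c 1, smul_mem_localTowerPointsOfEmb κ ι W g (hle hc1)⟩ : localTowerPointsOfEmb κ ι W) -
        ⟨c 1, hle hc1⟩ = -(2 • ⟨c 1 - s, hle hy₀⟩) := by
      apply Subtype.ext
      change g • c 1 - c 1 = -(2 • (c 1 - s))
      exact hgen
    rw [← map_sub, e, map_neg, map_nsmul, nsmul_eq_mul, Nat.cast_ofNat, hζ]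
  have hodd : ¬ (2 : ℤ_[2]) ∣ ζ ⟨c 1 - s, hy₀⟩ := by
    rintro ⟨t, ht⟩
    apply hz
    rw [hval, ht]
    exact ⟨-t, by ring⟩
  -- separation on the layer
  have hM2 : ∀ q : localLayerPointsOfEmb κ ι W 1, 2 • q = 0 → q = 0 := fun q hq ↦
    Subtype.ext (hnt q (hle q.2) (by rw [← AddSubgroupClass.coe_nsmul, hq, AddSubgroup.coe_zero]))
  have hndivM : ∀ q : localLayerPointsOfEmb κ ι W 1, 2 ^ k • q ≠ ⟨y, hy⟩ := fun q hq ↦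
    hndiv q q.2 (by rw [← AddSubgroupClass.coe_nsmul, hq])
  obtain ⟨u, hu⟩ := Literature.Algebra.Module.exists_addMonoidHom_padicInt_not_dvd (p := 2) hM2 hndivM
  have hu' : ¬ (2 : ℤ_[2]) ^ k ∣ u ⟨y, hy⟩ := by exact_mod_cast hu
  -- rank-one identity and the valuation count
  have hid := twistGenerator_mul_apply_eq hg hH hs hgen ζ u hy hgy
  intro hdvd
  rw [hζ y hy] at hid
  exact not_pow_dvd_mul_of_not_two_dvd hodd hu' (by rw [hid]; exact Dvd.dvd.mul_left hdvd _)

/-- **QUANTITATIVE WRONSKIAN CRITERION mod 4.**  Two functionals with Coleman values `(a₀, b₀)`, `(a₁, b₁)` whose Wronskian satisfies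
`4 ∤ (a₀b₁ − a₁b₀)(−2)` yield `z ∈ Ker Col♭` with `4 ∤ z(g·c₁) − z(c₁)` (`z = b₁•z₀ − b₀•z₁`, Coleman value `(a₀b₁ − a₁b₀, 0)`,
`Col♯(z)(−2) = z(g·c₁) − z(c₁)`); verbatim p811031's `…not_eight_dvd_of_wronskian` with `4` for `8`. [cite: Sprung2012, Def. 5.9 (p. 1495), Def. 7.9 (p. 1503)] -/
theorem exists_mem_colemanKer_flat_not_four_dvd_of_wronskian {ap : ℤ} {g : Field.absoluteGaloisGroup E}
    (hg : κ.IsTopGenerator (resGalOfEmb ι g)) {c : ℕ → localPoints W E}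
    (hc : ∀ n, c n ∈ localLayerPointsOfEmb κ ι W n)
    {z₀ z₁ : localTowerPointsOfEmb κ ι W →+ ℤ_[2]} {a₀ b₀ a₁ b₁ : IwasawaAlgebra 2}
    (h₀ : IsColemanPair κ ι W ap g c z₀ a₀ b₀) (h₁ : IsColemanPair κ ι W ap g c z₁ a₁ b₁)
    (hW : ¬ (4 : ℤ_[2]) ∣ evalAt (-2 : ℤ_[2]) (a₀ * b₁ - a₁ * b₀)) :
    ∃ z ∈ colemanKer κ ι W ap g c .flat,
      ¬ (4 : ℤ_[2]) ∣ z ⟨g • c 1, smul_mem_localTowerPointsOfEmb κ ι W g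
          (localLayerPointsOfEmb_le_localTowerPointsOfEmb κ ι W 1 (hc 1))⟩ -
        z ⟨c 1, localLayerPointsOfEmb_le_localTowerPointsOfEmb κ ι W 1 (hc 1)⟩ := by
  have hc1 := localLayerPointsOfEmb_le_localTowerPointsOfEmb κ ι W 1 (hc 1)
  obtain ⟨w₀, hw₀⟩ := h₀.exists_mul hg hc b₁
  obtain ⟨w₁, hw₁⟩ := h₁.exists_mul hg hc b₀
  have hz : IsColemanPair κ ι W ap g c (w₀ - w₁) (b₁ * a₀ - b₀ * a₁) (b₁ * b₀ - b₀ * b₁) := hw₀.sub hw₁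
  have hb : b₁ * b₀ - b₀ * b₁ = 0 := by ring
  rw [hb] at hz
  refine ⟨w₀ - w₁, ⟨b₁ * a₀ - b₀ * a₁, 0, hz, rfl⟩, ?_⟩
  rw [← evalAt_negTwo_sharp_of_isColemanPair_of_mem hc1 hz, show b₁ * a₀ - b₀ * a₁ = a₀ * b₁ - a₁ * b₀ by ring]
  exact hW

/-- **(D₁) ⟹ (K₄) for a Honda system at two**: an ODD Wronskian slope of two Coleman values gives `z ∈ Ker Col♭` with
`4 ∤ z(g·c₁) − z(c₁)` — p811031's `wronskian_constantCoeff_eq_zero` (`W(0) = 0`) and `not_four_dvd_evalAt_negTwo_of_not_two_dvd_coeff_one`,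
WITHOUT the weakening to `8`. [cite: Sprung2012, Def. 5.9 (p. 1495), Def. 7.9 (p. 1503)] [cite: KuriharaPollack2007, Prop. 1.2] -/
theorem exists_mem_colemanKer_flat_not_four_dvd_of_odd_slope {a : ℤ} {g : Field.absoluteGaloisGroup E}
    (hg : κ.IsTopGenerator (resGalOfEmb ι g)) {cneg : localPoints W E} {c : ℕ → localPoints W E}
    (hH : IsHondaSystemAtTwo κ ι W a g cneg c)
    {z₀ z₁ : localTowerPointsOfEmb κ ι W →+ ℤ_[2]} {a₀ b₀ a₁ b₁ : IwasawaAlgebra 2}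
    (h₀ : IsColemanPair κ ι W a g c z₀ a₀ b₀) (h₁ : IsColemanPair κ ι W a g c z₁ a₁ b₁)
    (hodd : ¬ (2 : ℤ_[2]) ∣ PowerSeries.coeff 1 (a₀ * b₁ - a₁ * b₀)) :
    ∃ z ∈ colemanKer κ ι W a g c .flat,
      ¬ (4 : ℤ_[2]) ∣ z ⟨g • c 1, smul_mem_localTowerPointsOfEmb κ ι W g
          (localLayerPointsOfEmb_le_localTowerPointsOfEmb κ ι W 1 (hH.2.1 1))⟩ -
        z ⟨c 1, localLayerPointsOfEmb_le_localTowerPointsOfEmb κ ι W 1 (hH.2.1 1)⟩ :=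
  exists_mem_colemanKer_flat_not_four_dvd_of_wronskian hg hH.2.1 h₀ h₁
    (not_four_dvd_evalAt_negTwo_of_not_two_dvd_coeff_one (wronskian_constantCoeff_eq_zero hg hH h₀ h₁) hodd)

end Generic

/-! ## §2 Over `ℚ` at `v ∋ 2`: the SHARP Honda rung, unconditionally -/

section Rat

/-- ★★ **THE SHARP HONDA RUNG (`e = 0`).**  For `W/ℚ` globally minimal, non-CM, `GoodSS W 2`, `a₂ ≠ 0`, odd sign, the cyclotomic `κ` with `γ`,
`v ∋ 2`, `g` a local lift of the topological generator, a system `c` with (L)(TR)(Z)(SAT) which is the `c`-part of a HONDA SYSTEM AT TWO: for every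
ψ₂-vector `y ∈ E(ℚ_{1,v})` (`g·y = −y`) and every `k` with `y ∉ 2^k·E(ℚ_{1,v})`, some `z ∈ Ker Col♭_c` has **`2^k ∤ z(y)`** — one power of `2`
sharper than the landed rung p811371 (`2^{k+1} ∤`), i.e. the ♭ functional is PRIMITIVE on the ψ₂-line and `L♭ ∩ (Kummer line) = 0`
EXACTLY (`t = e(c) = 0`, the transversality input of the CDC count).  Binders = the rung's VERBATIM; only the exponent in the conclusion changes.
Proof: Silverman VII.6.3 at layer `1` (DISCHARGED, `silvermanVII63_localLayerPoints_finiteIndex_zpLattice_holds`) ⟹ non-degenerate pair ⟹ (IND₁)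
(p811371 §1–§2) ⟹ odd Wronskian slope (p811115 `exists_oddSlope_of_independent`) ⟹ (K₄) (§1) ⟹ (Y″) (§1).
[cite: Sprung2012, Thm. 2.2, Lemma 2.3 (p. 1487), Def. 7.9 (p. 1503), Open Problem 7.22 (p. 1505)] [cite: SilvermanAEC2009, VII Prop. 6.3] -/
theorem flatBlindLocalTransversalityHondaOffZeroAtTwo_sharp :
    ∀ (W : WeierstrassCurve ℚ) [W.IsElliptic] [W.IsGloballyMinimal],
    ¬ W.HasCM → GoodSS W 2 → W.frobeniusTrace 2 ≠ 0 → W.rootNumber * ZMod.χ₈ (W.conductorNorm ℤ : ZMod 8) = -1 →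
    ∀ (κ : ZpExtension ℚ 2) (γ : Field.absoluteGaloisGroup ℚ),
      κ.IsCyclotomic → κ.IsTopGenerator γ → IsCyclotomicVariable 2 γ →
    ∀ (v : HeightOneSpectrum (𝓞 ℚ)), (2 : 𝓞 ℚ) ∈ v.asIdeal →
    ∀ (g : Field.absoluteGaloisGroup (v.adicCompletion ℚ)) (c : ℕ → localPoints W (v.adicCompletion ℚ)),
      κ.IsTopGenerator (resGalOfEmb (closureEmb (K := ℚ) (v.adicCompletion ℚ)) g) →
      (∀ n, c n ∈ localLayerPointsOfEmb κ (closureEmb (K := ℚ) (v.adicCompletion ℚ)) W n) →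
      (∀ n, 1 ≤ n → localTraceOfEmb κ (closureEmb (K := ℚ) (v.adicCompletion ℚ)) W n (n + 1)
        (c (n + 1)) = W.frobeniusTrace 2 • c n - c (n - 1)) →
      (∀ z₀ : localLayerPointsOfEmb κ (closureEmb (K := ℚ) (v.adicCompletion ℚ)) W 0 →+ ℤ_[2],
        evalOn W (localLayerPointsOfEmb κ (closureEmb (K := ℚ) (v.adicCompletion ℚ)) W 0) z₀ (c 0) = 0 →
          z₀ = 0) →
      (∀ a : ℤ_[2],
        (∃ z₀ : localLayerPointsOfEmb κ (closureEmb (K := ℚ) (v.adicCompletion ℚ)) W 0 →+ ℤ_[2],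
          evalOn W (localLayerPointsOfEmb κ (closureEmb (K := ℚ) (v.adicCompletion ℚ)) W 0) z₀ (c 0) = 2 * a) →
        ∃ y : localLayerPointsOfEmb κ (closureEmb (K := ℚ) (v.adicCompletion ℚ)) W 0 →+ ℤ_[2],
          evalOn W (localLayerPointsOfEmb κ (closureEmb (K := ℚ) (v.adicCompletion ℚ)) W 0) y (c 0) = a) →
      (∃ cneg : localPoints W (v.adicCompletion ℚ),
        Summit.BirchSwinnertonDyer.Rank1Residual.F1Sign2.IsHondaSystemAtTwo κ (closureEmb (K := ℚ) (v.adicCompletion ℚ)) W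
          (W.frobeniusTrace 2) g cneg c) →
      ∀ (y : localPoints W (v.adicCompletion ℚ))
        (hy : y ∈ localLayerPointsOfEmb κ (closureEmb (K := ℚ) (v.adicCompletion ℚ)) W 1), g • y = -y →
        ∀ k : ℕ, (∀ w ∈ localLayerPointsOfEmb κ (closureEmb (K := ℚ) (v.adicCompletion ℚ)) W 1, 2 ^ k • w ≠ y) →
          ∃ z ∈ colemanKer κ (closureEmb (K := ℚ) (v.adicCompletion ℚ)) W (W.frobeniusTrace 2) g c .flat,
            ¬ (2 : ℤ_[2]) ^ k ∣
              z ⟨y, localLayerPointsOfEmb_le_localTowerPointsOfEmb κ (closureEmb (K := ℚ) (v.adicCompletion ℚ)) W 1 hy⟩ := by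
  intro W _ _ _hCM hss _ha _hodd κ _γ _hκ _hγ _hcv v hv g c hg _hc _htr _hz _hsat hH y hy hgy k hndiv
  obtain ⟨cneg, hH⟩ := hH
  have hv' : ((2 : ℕ) : 𝓞 ℚ) ∈ v.asIdeal := by exact_mod_cast hv
  have hnt := SignedKatoOffTwo.SignedIntersection.noTwoTorsion_localTowerPointsOfEmb_adicCompletion W hss κ v hv
    (closureEmb (K := ℚ) (v.adicCompletion ℚ))
  -- (IND₁) from the layer-one lattice
  obtain ⟨H, hHle, hfin, hφ⟩ := silvermanVII63_localLayerPoints_finiteIndex_zpLattice.rat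
    silvermanVII63_localLayerPoints_finiteIndex_zpLattice_holds κ hv' (closureEmb (K := ℚ) (v.adicCompletion ℚ)) W 1
  rw [index_localLayerSubgroupOfEmb_eq_pow_of_isTopGenerator κ (closureEmb (K := ℚ) (v.adicCompletion ℚ)) hg 1, pow_one] at hφ
  obtain ⟨φ⟩ := hφ
  have hind := independent_of_nondegeneratePair hnt hss.2 hg hH (exists_nondegeneratePair_of_lattice hHle hfin φ)
  -- (D₁): odd Wronskian slope; (K₄); (Y″)
  obtain ⟨z₀, z₁, a₀, b₀, a₁, b₁, h₀, h₁, hodd⟩ := exists_oddSlope_of_independent hnt hss.2 hg hH hind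
  obtain ⟨z, hzK, hz4⟩ := exists_mem_colemanKer_flat_not_four_dvd_of_odd_slope hg hH h₀ h₁ hodd
  exact ⟨z, hzK, not_pow_dvd_apply_of_not_four_dvd hnt hg hH z hz4 hy hgy hndiv⟩

end Rat

end OddBlindLocal

end Summit.BirchSwinnertonDyer.BirchSwinnertonDyer.Theorems

end
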